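import Summits.Ventures.MM22.Rank333.ProfileCertL494AsmB0
import Summits.Ventures.MM22.Rank333.GF2ProfileSymmetrySub
import HarnessLib

/-!
# MM22 venture — PROFILE-CERT kernel replay DATA (sub-instance 494): ASSEMBLY — `Cert 3 3 3 [84] 20` from the lift hypotheses

HONEST FRAMING (cell `pub-mm22`, seat bench g6; V4-MENU item (0′), object «494 @ 20»). Generated by `pc2treeS.py` from p2 g4's
sub-instance certificate `lift494_at20_on_4dim2_evencomp.pcert` (sha256 b8ae5e67afcf…; «evencomp» convention; VALID under p2's and the referee's
conventional checkers) — the end theorem of the sub-instance: orbit 494 of Wang's table needs ≥ 20 products, CONDITIONAL on exactly the lifted orbits [487, 488, 490, 491] (hypotheses until their kernel replays `Lift333.lift_<w>` land). Every theorem here is a `decide +kernel` (or `rfl`/`decide`) about the checkers of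
`ProfileCertKernel` (p1 g5); its MEANING is supplied by p1's `ProfileCertSub`/`ProfileCertSubSym`, LIT-2's `GF2ProfileRowsSub`/`GF2ProfileSymmetrySub` and the assembly files. Nothing here
is a bound on `R_𝔽₂(⟨3,3,3⟩)`; no summit claim.
-/

set_option autoImplicit false
set_option maxRecDepth 200000
set_option maxHeartbeats 0

namespace Summit.Ventures.MM22.ProfileCert.L494

open Summit.MatrixMultiplication.OmegaCensus.GF2RankLB Summit.Ventures.MM22.ProfileCert

open Summit.MatrixMultiplication.OmegaCensus.GF2RankLB Summit.Ventures.MM22.GF2Cert.Profile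

/-- The even-parity representative map of the instance (p2's «evencomp» convention): xor with `84` on odd
`84`-parity. -/
def red494 (g : ℕ) : ℕ := if bdot (3 * 3) 84 g then g ^^^ 84 else g

/-- `red494` does not change restrictions to `S_[84]` (`form (g ⊕ 84) = form g + form 84`). -/
theorem red494_form (g : ℕ) : ∀ u ∈ subOf 3 3 [84], form 3 3 (red494 g) u = form 3 3 g u := by
  intro u hu
  unfold red494
  split
  · exact form_xor_eq_of_mem (l := 3) (m := 3) (K := [84]) (by simp) g u hu
  · rfl

/-- The universe `pcFU` covers every pattern `< 512` through `red494` (0 or a member). -/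
theorem pcFU_cover : coverByB 3 3 red494 pcFU = true := by decide +kernel

/-- **`Cert 3 3 3 [84] 20` (orbit 494 of Wang's `⟨3,3,3⟩/𝔽₂` table lifted to 20)** from the lift hypotheses
[487, 488, 490, 491] (the cited planes, discharged by p3's `Lift333.lift_<w>` once landed), everything else
kernel-checked: Wang's printed table (p3's chain: `Lift333.certX`, `Top333.cert_codim1_84`), the relative singleton rows,
the sub-instance PROFILE-CERT replay (38 chunks, 1678-row store with its dictionary; S-nodes via the per-generator
pointwise-fix test) and the checkers' soundness (p1's `ProfileCertSub`/`ProfileCertSubSym`, LIT-2's `GF2ProfileRowsSub` /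
`GF2ProfileSymmetrySub`). No summit claim. -/
theorem lift494 (h487 : Cert 3 3 3 [10, 84] 19) (h488 : Cert 3 3 3 [10, 96] 19) (h490 : Cert 3 3 3 [10, 275] 19) (h491 : Cert 3 3 3 [84, 163] 19) : Cert 3 3 3 [84] 20 :=
  cert_succ_of_noValidSetSub_of_coverBy Summit.Ventures.MM22.GF2Cert.Top333.cert_codim1_84 red494_form pcFU
    pcFU_cover (pcSingles_cert h487 h488 h490 h491)
    (noValidSet_of_noExt (forms_of_allFormsB pcFU_ok.2) (out_avoids_of_B pcFU_ok.1) (ne37 h487 h488 h490 h491))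

end Summit.Ventures.MM22.ProfileCert.L494
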